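/-
Copyright (c) 2026. All rights reserved.
Released under Apache 2.0 license as described in the file LICENSE.
-/
import Literature.Geometry.Kaehler.ComplexTorusQuaternionSpecialVectorStabilizers
import Literature.Geometry.Kaehler.ComplexTorusQuaternionCongruenceLevelStructures
import HarnessLib

/-!
# `Aut(X, S) ≅ (End(X) ∩ Z(S))^×` for a complex torus with extra structure, and the three avatars of `Aut(A(τ), ι)`
# for Lang's quaternionic family — holomorphic `ι(𝔬)`-equivariant group automorphisms of the torus, units of
# `End(A(τ), ι)`, the stabilizer `Γ_τ` — have the same order `w(A(τ), ι) ∈ {2, 4}`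
# (Lange–Birkenhake Prop. 1.1.6 / Cor. 1.1.16 (b); Kudla–Rapoport–Yang 2006 §3.1, §3.2 Prop. 3.2.1)

[tag: complex_torus] [tag: abelian_surface] [tag: quaternion_multiplication] [tag: endomorphism_ring]
[tag: automorphism_group] [tag: shimura_curve] [tag: special_cycles]

Lane `lit-hodgefound`, seat p12, row g27-#3 — closes the triangle between the three descriptions of the automorphism
group of a member `(A(τ), ι)` of the quaternionic family that the tree now holds: (1) g18-#3/#4
`…QuaternionCongruenceLevelStructures` §5 — holomorphic group automorphisms `e : A(τ) ⥲ A(τ)` with holomorphic inverse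
commuting with `ι(𝔬) = {ρ_r(L_α)}` (`exists_unit_eq_mapMatrix_of_addEquiv`, `addEquiv_eq_refl_or_eq_neg`,
`neg_isAutomorphism`); (2) g27-#1 `…QuaternionEquivariantAutomorphisms` — the unit group `End(A(τ), ι)^×` of g26-#3's
integral ring, `w(A(τ), ι) = #End(A(τ), ι)^× ∈ {2, 4}`, `= #Γ_τ` (`natCard_units_eq_ncard_stabilizer`,
`natCard_units_eq_four_iff_exists_smul_eq`, `isUnit_iff_of_eq_neg_one`, …); (3) g15-#1/#3 — the stabilizer `Γ_τ` in
`Γ = ρ(𝔬¹)`. §1 is a GENERAL torus-level statement (any `X = E/Φ(ℤ^ι)`, any set `S ⊆ M_ι(ℤ)` of integral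
endomorphisms as extra structure): the holomorphic group automorphisms of `X` commuting with `ρ_r(S)` are exactly
the `ρ_r(u)`, `u` a unit of the subring `End(X) ∩ Z(S)` of `M_ι(ℤ)` (Lange–Birkenhake Prop. 1.1.6: every holomorphic
homomorphism is `ρ_r` of an integer matrix, the tree's `exists_mapMatrix_linear_of_mdifferentiable`,
`mem_endRingInt_iff_contMDiff`, `mapMatrix_injective`, `mapMatrix_mapMatrix` BY NAME); §2 specialises to `S = ι(𝔬)`
(g26-#3: `End(A(τ), ι) := End(A(τ)) ⊓ Z(ι(𝔬))`, definitionally). Nothing restated.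

## The print, VERBATIM

H. Lange, Ch. Birkenhake, *Complex Abelian Varieties* (1992) / H. Lange, *Abelian Varieties over the Complex Numbers*
(2023) [LangeBirkenhake1992] [Lange2023AbelianVarietiesComplex], §1.1.2 (held `book:lange1992-complex-abelian-varieties`
p0019–p0022): Prop. 1.1.6 «There is a unique `ℂ`-linear map `F : V → V′` with `F(Λ) ⊂ Λ′` inducing the homomorphism»
(the analytic and rational representations `ρ_a`, `ρ_r`), «`ρ_r : Hom(X, X′) → Hom_ℤ(Λ, Λ′)` […] injective»,
Cor. 1.1.16 (b) «An element in `End(X)` is an isogeny if and only if it is invertible in `End_ℚ(X)`» (so the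
automorphisms of `X` are the units of `End(X)`, `det ρ_r = ±1`). S. Kudla, M. Rapoport, T. Yang, *Modular Forms and
Special Cycles on Shimura Curves* (2006) [KudlaRapoportYang2006] (held, printed page = pdf − 2) §3.1 p. 46: «The
morphisms in this category are the isomorphisms of such objects»; §3.2 p. 48 (proof of Prop. 3.2.1): «Furthermore, the
automorphisms of `(A_z, ι_z)` are given by elements in `Γ_z`.»

## What is proved (theorems only; no definition, no named fact, no instance)

* §1 (namespace `…ComplexTorus`; any `Φ : (ι → ℝ) ≃L[ℝ] E`, `S : Set (Matrix ι ι ℤ)`; the automorphisms are the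
  `e : ComplexTorus Φ ≃+ ComplexTorus Φ` with `e`, `e.symm` holomorphic and `e ∘ ρ_r(s) = ρ_r(s) ∘ e` for `s ∈ S`):
  **`exists_units_coe_eq_of_addEquiv`** (every such `e` is `ρ_r(u)`, `e⁻¹ = ρ_r(u⁻¹)`, for a unit `u` of
  `endRingInt Φ ⊓ Subring.centralizer S`), **`exists_addEquiv_coe_eq_of_units`** (conversely every unit is such an
  automorphism), **`ncard_setOf_addEquiv_eq_natCard_units`** (the two sets are in bijection: `#Aut(X, S) =
  #(End(X) ∩ Z(S))^×` as `Set.ncard` / `Nat.card`), `ncard_setOf_addEquiv_eq_natCard_units_endRingInt` (`S = ∅`: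
  **`#Aut(X) = #End(X)^×`**).
* §2 (namespace `…QuaternionType`; `τ ∈ 𝔥`, `S = ι(𝔬) = range lmulInt`): **`ncard_setOf_addEquiv_eq_natCard_units`**
  (`#{e : (A(τ), ι) ⥲ (A(τ), ι)} = #End(A(τ), ι)^× = w(A(τ), ι)`), `ncard_setOf_addEquiv_eq_two_or_eq_four`,
  **`ncard_setOf_addEquiv_eq_ncard_stabilizer`** (`= #Γ_τ` — KRY's sentence as an equality of cardinalities),
  **`ncard_setOf_addEquiv_eq_four_iff_exists_smul_eq`** (`= 4` iff `τ` is an elliptic point), `setOf_addEquiv_eq_pair_of_not_exists`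
  (off the elliptic points the set IS `{1, −1}` — g18-#3's two theorems as a set equality) and
  `setOf_addEquiv_ne_pair_of_exists` (at the elliptic points it is not), **`exists_coe_addEquiv_eq_mapMatrix`**
  (hypothesis-free: every automorphism of `(A(τ), ι)` is `ρ_r(M)` with `M = ±1`, or `M = ±x̃_p` for the primitive
  special vector `p` of a CM point with `t_p = 1`), validation `ncard_setOf_addEquiv_neg_one_three_I` (`(−1,3)`, `τ = i`:
  exactly `4` automorphisms).

## Honest scope

Group automorphisms of the complex torus (`≃+`, holomorphic both ways) commuting with the given integral
endomorphisms; no polarisation / level structure is imposed (g18-#3 treats level `N`); `Γ = ρ(𝔬¹)` on `𝔥` as in g15;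
the sets are compared by cardinality and described explicitly, no group isomorphism `Aut ≅ Γ_τ/…` as a `MulEquiv` is
constructed (the composition law on the `≃+` side is not packaged). Everything is proved; 0 definitions, 0 named
facts, 0 instances.

## References
* [LangeBirkenhake1992] H. Lange, Ch. Birkenhake, Complex Abelian Varieties, Grundlehren 302 (1992), §1.1.2 Prop. 1.1.6,
  Cor. 1.1.16 (b).
* [Lange2023AbelianVarietiesComplex] H. Lange, Abelian Varieties over the Complex Numbers (2023), §1.1.2 Prop. 1.1.13,
  Cor. 1.1.16 (b).
* [KudlaRapoportYang2006] S. Kudla, M. Rapoport, T. Yang, Modular Forms and Special Cycles on Shimura Curves, Ann. of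
  Math. Stud. 161 (2006), §3.1 Prop. 3.1.1 p. 46; §3.2 Prop. 3.2.1 (proof) p. 48; §3.4 Def. 3.4.2, (3.4.6), (3.4.8) p. 51.
* [Lang1982AbelianFunctions] S. Lang, Introduction to Algebraic and Abelian Functions, 2nd ed. (1982), Ch. IX §4, §5 Thm. 5.1.
* [Bergeron2016] N. Bergeron, The Spectrum of Hyperbolic Surfaces (2016), §1.3.1 p. 19.
* [BesserLivne2013] A. Besser, R. Livné, Universal Kummer families over Shimura curves (2013), §3.4 Cor. 2.
-/

noncomputable section

open Complex Module Matrix Function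
open scoped Manifold ContDiff MatrixGroups

namespace Literature.Geometry.Kaehler.ComplexTorus

/-! ## §1 Any complex torus `X = E/Φ(ℤ^ι)` with extra structure `S ⊆ M_ι(ℤ)`: the holomorphic group automorphisms of
`X` commuting with `ρ_r(s)`, `s ∈ S`, are exactly the `ρ_r(u)`, `u ∈ (End(X) ∩ Z(S))^×` -/

section General

variable {ι : Type*} [Fintype ι] [DecidableEq ι] {E : Type*} [NormedAddCommGroup E] [NormedSpace ℂ E]
  (Φ : (ι → ℝ) ≃L[ℝ] E) (S : Set (Matrix ι ι ℤ))

/-- Two integer matrices commute with each other's inverses: if `BA = 1 = AB` and `As = sA` then `Bs = sB`. [folklore] -/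
private theorem inv_comm_of_comm {A B s : Matrix ι ι ℤ} (hBA : B * A = 1) (hAB : A * B = 1) (h : A * s = s * A) :
    B * s = s * B := by
  calc B * s = B * s * (A * B) := by rw [hAB, Matrix.mul_one]
    _ = B * (s * A) * B := by simp only [Matrix.mul_assoc]
    _ = B * (A * s) * B := by rw [h]
    _ = s * B := by rw [← Matrix.mul_assoc, hBA, Matrix.one_mul]

/-- **Every holomorphic group automorphism of `X = E/Φ(ℤ^ι)` commuting with the endomorphisms `ρ_r(s)`, `s ∈ S`, is
`ρ_r(u)` for a unit `u` of the ring `End(X) ∩ Z(S)`** (integer matrices in `End(X)` centralising `S`): by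
Lange–Birkenhake Prop. 1.1.6 the automorphism and its inverse are `ρ_r(A)`, `ρ_r(B)` with `AB = BA = 1`, both
holomorphic (`A, B ∈ End(X)`), and `A` centralises `S` because `ρ_r` is faithful.
[cite: LangeBirkenhake1992, §1.1.2 Prop. 1.1.6 and Cor. 1.1.16 (b)] [cite: Lange2023AbelianVarietiesComplex, §1.1.2 Cor. 1.1.16 (b)] -/
theorem exists_units_coe_eq_of_addEquiv (e : ComplexTorus Φ ≃+ ComplexTorus Φ)
    (he : ContMDiff 𝓘(ℂ, E) 𝓘(ℂ, E) ω e) (he' : ContMDiff 𝓘(ℂ, E) 𝓘(ℂ, E) ω e.symm)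
    (hcomm : ∀ s ∈ S, ∀ t, e (mapMatrix Φ Φ s t) = mapMatrix Φ Φ s (e t)) :
    ∃ u : ((endRingInt Φ ⊓ Subring.centralizer S : Subring (Matrix ι ι ℤ)))ˣ,
      ⇑e = mapMatrix Φ Φ ((u : (endRingInt Φ ⊓ Subring.centralizer S : Subring (Matrix ι ι ℤ))) : Matrix ι ι ℤ) ∧
      ⇑e.symm = mapMatrix Φ Φ ((u⁻¹ : ((endRingInt Φ ⊓ Subring.centralizer S : Subring (Matrix ι ι ℤ)))ˣ) : Matrix ι ι ℤ) := by
  obtain ⟨A, -, hA, -⟩ := exists_mapMatrix_linear_of_mdifferentiable (h := e.toAddMonoidHom)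
    (he.mdifferentiable (by simp))
  obtain ⟨B, -, hB, -⟩ := exists_mapMatrix_linear_of_mdifferentiable (h := e.symm.toAddMonoidHom)
    (he'.mdifferentiable (by simp))
  rw [AddEquiv.coe_toAddMonoidHom] at hA hB
  have hBA : B * A = 1 := mapMatrix_injective (Φ := Φ) (Φ' := Φ) (funext fun t ↦ by
    rw [← mapMatrix_mapMatrix (Φ := Φ) (Φ' := Φ) (Φ'' := Φ) B A t, mapMatrix_one, ← hA, ← hB,
      AddEquiv.symm_apply_apply])
  have hAB : A * B = 1 := mapMatrix_injective (Φ := Φ) (Φ' := Φ) (funext fun t ↦ by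
    rw [← mapMatrix_mapMatrix (Φ := Φ) (Φ' := Φ) (Φ'' := Φ) A B t, mapMatrix_one, ← hA, ← hB,
      AddEquiv.apply_symm_apply])
  have hAend : A ∈ endRingInt Φ := (mem_endRingInt_iff_contMDiff Φ (n := ω) (by simp)).2 (hA ▸ he)
  have hBend : B ∈ endRingInt Φ := (mem_endRingInt_iff_contMDiff Φ (n := ω) (by simp)).2 (hB ▸ he')
  have hAcomm : ∀ s ∈ S, A * s = s * A := fun s hs ↦ mapMatrix_injective (Φ := Φ) (Φ' := Φ) (funext fun t ↦ by
    rw [← mapMatrix_mapMatrix (Φ := Φ) (Φ' := Φ) (Φ'' := Φ) A s t,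
      ← mapMatrix_mapMatrix (Φ := Φ) (Φ' := Φ) (Φ'' := Φ) s A t, ← hA, hcomm s hs t])
  have hAc : A ∈ Subring.centralizer S := Subring.mem_centralizer_iff.2 fun s hs ↦ (hAcomm s hs).symm
  have hBc : B ∈ Subring.centralizer S :=
    Subring.mem_centralizer_iff.2 fun s hs ↦ (inv_comm_of_comm hBA hAB (hAcomm s hs)).symm
  refine ⟨⟨⟨A, Subring.mem_inf.2 ⟨hAend, hAc⟩⟩, ⟨B, Subring.mem_inf.2 ⟨hBend, hBc⟩⟩, Subtype.ext hAB, Subtype.ext hBA⟩,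
    hA, hB⟩

/-- **… and conversely every unit `u` of `End(X) ∩ Z(S)` is (the rational representation of) such an automorphism**:
`ρ_r(u)` with inverse `ρ_r(u⁻¹)`, holomorphic (`u ∈ End(X)`, Prop. 1.1.6) and commuting with `ρ_r(S)`.
[cite: LangeBirkenhake1992, §1.1.2 Prop. 1.1.6 and Cor. 1.1.16 (b)] [cite: Lange2023AbelianVarietiesComplex, §1.1.2 Cor. 1.1.16 (b)] -/
theorem exists_addEquiv_coe_eq_of_units (u : ((endRingInt Φ ⊓ Subring.centralizer S : Subring (Matrix ι ι ℤ)))ˣ) :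
    ∃ e : ComplexTorus Φ ≃+ ComplexTorus Φ, ContMDiff 𝓘(ℂ, E) 𝓘(ℂ, E) ω e ∧ ContMDiff 𝓘(ℂ, E) 𝓘(ℂ, E) ω e.symm ∧
      (∀ s ∈ S, ∀ t, e (mapMatrix Φ Φ s t) = mapMatrix Φ Φ s (e t)) ∧
      ⇑e = mapMatrix Φ Φ ((u : (endRingInt Φ ⊓ Subring.centralizer S : Subring (Matrix ι ι ℤ))) : Matrix ι ι ℤ) := by
  set A : Matrix ι ι ℤ := ((u : (endRingInt Φ ⊓ Subring.centralizer S : Subring (Matrix ι ι ℤ))) : Matrix ι ι ℤ) with hA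
  set B : Matrix ι ι ℤ := ((u⁻¹ : ((endRingInt Φ ⊓ Subring.centralizer S : Subring (Matrix ι ι ℤ)))ˣ) : Matrix ι ι ℤ) with hB
  have hBA : B * A = 1 := by
    rw [hA, hB, ← Subring.coe_mul, Units.inv_mul, Subring.coe_one]
  have hAB : A * B = 1 := by
    rw [hA, hB, ← Subring.coe_mul, Units.mul_inv, Subring.coe_one]
  have hAmem := Subring.mem_inf.1 (u : (endRingInt Φ ⊓ Subring.centralizer S : Subring (Matrix ι ι ℤ))).2
  have hBmem := Subring.mem_inf.1 ((u⁻¹ : ((endRingInt Φ ⊓ Subring.centralizer S : Subring (Matrix ι ι ℤ)))ˣ) :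
    (endRingInt Φ ⊓ Subring.centralizer S : Subring (Matrix ι ι ℤ))).2
  refine ⟨{ toFun := mapMatrix Φ Φ A
            invFun := mapMatrix Φ Φ B
            left_inv := fun t ↦ by rw [mapMatrix_mapMatrix, hBA, mapMatrix_one]
            right_inv := fun t ↦ by rw [mapMatrix_mapMatrix, hAB, mapMatrix_one]
            map_add' := mapMatrix_add _ }, ?_, ?_, fun s hs t ↦ ?_, rfl⟩
  · exact (mem_endRingInt_iff_contMDiff Φ (n := ω) (by simp)).1 hAmem.1
  · exact (mem_endRingInt_iff_contMDiff Φ (n := ω) (by simp)).1 hBmem.1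
  · change mapMatrix Φ Φ A (mapMatrix Φ Φ s t) = mapMatrix Φ Φ s (mapMatrix Φ Φ A t)
    rw [mapMatrix_mapMatrix, mapMatrix_mapMatrix, Subring.mem_centralizer_iff.1 hAmem.2 s hs]

/-- **`Aut(X, S) ≅ (End(X) ∩ Z(S))^×` as a count**: the holomorphic group automorphisms of `X` commuting with `ρ_r(S)`
are in bijection with the units of `End(X) ∩ Z(S)` (`e ↦ ρ_r⁻¹(e)`; `ρ_r` is faithful), so the two sets have the same
cardinality (`Nat.card`, `0` if infinite). [cite: LangeBirkenhake1992, §1.1.2 Prop. 1.1.6 and Cor. 1.1.16 (b)] [cite: Lange2023AbelianVarietiesComplex, §1.1.2 Cor. 1.1.16 (b)] -/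
theorem ncard_setOf_addEquiv_eq_natCard_units :
    {e : ComplexTorus Φ ≃+ ComplexTorus Φ | ContMDiff 𝓘(ℂ, E) 𝓘(ℂ, E) ω e ∧ ContMDiff 𝓘(ℂ, E) 𝓘(ℂ, E) ω e.symm ∧
        ∀ s ∈ S, ∀ t, e (mapMatrix Φ Φ s t) = mapMatrix Φ Φ s (e t)}.ncard =
      Nat.card ((endRingInt Φ ⊓ Subring.centralizer S : Subring (Matrix ι ι ℤ)))ˣ := by
  have key : ∀ e : {e : ComplexTorus Φ ≃+ ComplexTorus Φ | ContMDiff 𝓘(ℂ, E) 𝓘(ℂ, E) ω e ∧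
      ContMDiff 𝓘(ℂ, E) 𝓘(ℂ, E) ω e.symm ∧ ∀ s ∈ S, ∀ t, e (mapMatrix Φ Φ s t) = mapMatrix Φ Φ s (e t)},
      ∃ u : ((endRingInt Φ ⊓ Subring.centralizer S : Subring (Matrix ι ι ℤ)))ˣ,
      ⇑(e : ComplexTorus Φ ≃+ ComplexTorus Φ) =
        mapMatrix Φ Φ ((u : (endRingInt Φ ⊓ Subring.centralizer S : Subring (Matrix ι ι ℤ))) : Matrix ι ι ℤ) :=
    fun e ↦ by
      obtain ⟨u, hu, -⟩ := exists_units_coe_eq_of_addEquiv Φ S e.1 e.2.1 e.2.2.1 e.2.2.2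
      exact ⟨u, hu⟩
  choose f hf using key
  rw [← Nat.card_coe_set_eq]
  refine Nat.card_eq_of_bijective f ⟨fun e e' h ↦ ?_, fun u ↦ ?_⟩
  · have h1 := hf e
    rw [h, ← hf e'] at h1
    exact Subtype.ext (AddEquiv.ext fun t ↦ congrFun h1 t)
  · obtain ⟨e, he, he', hcomm, heu⟩ := exists_addEquiv_coe_eq_of_units Φ S u
    refine ⟨⟨e, he, he', hcomm⟩, ?_⟩
    have h2 := heu.symm.trans (hf ⟨e, he, he', hcomm⟩)
    exact Units.ext (Subtype.ext (mapMatrix_injective h2).symm)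

/-- **`#Aut(X) = #End(X)^×`** (the case `S = ∅`: all holomorphic group automorphisms of the complex torus `X`;
«the automorphisms of `X` are the units of `End(X)`»). [cite: LangeBirkenhake1992, §1.1.2 Prop. 1.1.6 and Cor. 1.1.16 (b)] [cite: Lange2023AbelianVarietiesComplex, §1.1.2 Cor. 1.1.16 (b)] -/
theorem ncard_setOf_addEquiv_eq_natCard_units_endRingInt :
    {e : ComplexTorus Φ ≃+ ComplexTorus Φ | ContMDiff 𝓘(ℂ, E) 𝓘(ℂ, E) ω e ∧ ContMDiff 𝓘(ℂ, E) 𝓘(ℂ, E) ω e.symm}.ncard =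
      Nat.card (endRingInt Φ)ˣ := by
  have h := ncard_setOf_addEquiv_eq_natCard_units Φ ∅
  simp only [Set.mem_empty_iff_false, false_imp_iff, imp_true_iff, and_true] at h
  rw [h]
  have hc : (endRingInt Φ ⊓ Subring.centralizer (∅ : Set (Matrix ι ι ℤ)) : Subring (Matrix ι ι ℤ)) = endRingInt Φ := by
    rw [(Subring.centralizer_eq_top_iff_subset).2 (Set.empty_subset _), inf_top_eq]
  exact Nat.card_congr (Units.mapEquiv (RingEquiv.subringCongr hc).toMulEquiv).toEquiv

end General

/-! ## §2 Lang's quaternionic family: the holomorphic `ι(𝔬)`-equivariant group automorphisms of `A(τ)` (g18-#3's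
avatar of `Aut(A(τ), ι)`) are counted by `w(A(τ), ι) = #End(A(τ), ι)^× = #Γ_τ ∈ {2, 4}` -/

namespace QuaternionType

variable {a b : ℤ} (ha : a ≠ 0) (hb : 0 < b)

/-- **The three avatars of `Aut(A(τ), ι)` have the same order, I: automorphisms of the torus vs. units of
`End(A(τ), ι)`.** The holomorphic group automorphisms `e : A(τ) ⥲ A(τ)` (holomorphic inverse) commuting with the
quaternionic multiplication `ι(𝔬) = {ρ_r(L_α)}` — the automorphisms of the object `(A(τ), ι)` of KRY's `𝓜(ℂ)` — are
exactly the `ρ_r(u)`, `u ∈ End(A(τ), ι)^×` (§1 with `S = ι(𝔬)`; g26-#3's `End(A(τ), ι) = End(A(τ)) ∩ Z(ι(𝔬))`), so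
their number is `w(A(τ), ι) = #End(A(τ), ι)^×` (g27-#1). [cite: KudlaRapoportYang2006, §3.1 p. 46 («The morphisms in this category are the isomorphisms of such objects») and §3.2 Prop. 3.2.1 (proof) p. 48] [cite: LangeBirkenhake1992, §1.1.2 Prop. 1.1.6] -/
theorem ncard_setOf_addEquiv_eq_natCard_units (τ : UpperHalfPlane) :
    {e : ComplexTorus (period a b ha hb τ.coe_im_pos.ne') ≃+ ComplexTorus (period a b ha hb τ.coe_im_pos.ne') |
        ContMDiff 𝓘(ℂ, Fin 2 → ℂ) 𝓘(ℂ, Fin 2 → ℂ) ω e ∧ ContMDiff 𝓘(ℂ, Fin 2 → ℂ) 𝓘(ℂ, Fin 2 → ℂ) ω e.symm ∧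
        ∀ m : Fin 4 → ℤ, ∀ t, e (mapMatrix (period a b ha hb τ.coe_im_pos.ne') (period a b ha hb τ.coe_im_pos.ne')
          (lmulInt a b m) t) = mapMatrix (period a b ha hb τ.coe_im_pos.ne') (period a b ha hb τ.coe_im_pos.ne')
          (lmulInt a b m) (e t)}.ncard =
      Nat.card (equivariantEndRingInt ha hb τ.coe_im_pos.ne')ˣ := by
  have h := ComplexTorus.ncard_setOf_addEquiv_eq_natCard_units (period a b ha hb τ.coe_im_pos.ne')
    (Set.range (lmulInt a b))
  simp only [Set.forall_mem_range] at h
  exact h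

/-- **II: `#Aut(A(τ), ι) ∈ {2, 4}` for the automorphisms of the torus** (g27-#1 `natCard_units_eq_two_or_eq_four`).
[cite: KudlaRapoportYang2006, §3.2 Prop. 3.2.1 (proof) p. 48] [cite: Bergeron2016, §1.3.1 p. 19] -/
theorem ncard_setOf_addEquiv_eq_two_or_eq_four (τ : UpperHalfPlane) :
    {e : ComplexTorus (period a b ha hb τ.coe_im_pos.ne') ≃+ ComplexTorus (period a b ha hb τ.coe_im_pos.ne') |
        ContMDiff 𝓘(ℂ, Fin 2 → ℂ) 𝓘(ℂ, Fin 2 → ℂ) ω e ∧ ContMDiff 𝓘(ℂ, Fin 2 → ℂ) 𝓘(ℂ, Fin 2 → ℂ) ω e.symm ∧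
        ∀ m : Fin 4 → ℤ, ∀ t, e (mapMatrix (period a b ha hb τ.coe_im_pos.ne') (period a b ha hb τ.coe_im_pos.ne')
          (lmulInt a b m) t) = mapMatrix (period a b ha hb τ.coe_im_pos.ne') (period a b ha hb τ.coe_im_pos.ne')
          (lmulInt a b m) (e t)}.ncard = 2 ∨
    {e : ComplexTorus (period a b ha hb τ.coe_im_pos.ne') ≃+ ComplexTorus (period a b ha hb τ.coe_im_pos.ne') |
        ContMDiff 𝓘(ℂ, Fin 2 → ℂ) 𝓘(ℂ, Fin 2 → ℂ) ω e ∧ ContMDiff 𝓘(ℂ, Fin 2 → ℂ) 𝓘(ℂ, Fin 2 → ℂ) ω e.symm ∧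
        ∀ m : Fin 4 → ℤ, ∀ t, e (mapMatrix (period a b ha hb τ.coe_im_pos.ne') (period a b ha hb τ.coe_im_pos.ne')
          (lmulInt a b m) t) = mapMatrix (period a b ha hb τ.coe_im_pos.ne') (period a b ha hb τ.coe_im_pos.ne')
          (lmulInt a b m) (e t)}.ncard = 4 := by
  rw [ncard_setOf_addEquiv_eq_natCard_units ha hb τ]
  exact natCard_units_eq_two_or_eq_four ha hb _

/-- **III: `#Aut(A(τ), ι) = #Γ_τ` — «the automorphisms of `(A_z, ι_z)` are given by elements in `Γ_z`», as an equality
of cardinalities between g18-#3's automorphisms of the torus and g15's stabilizer in `Γ = ρ(𝔬¹)`** (through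
`End(A(τ), ι)^×`, g27-#1 `natCard_units_eq_ncard_stabilizer`). [cite: KudlaRapoportYang2006, §3.2 Prop. 3.2.1 (proof) p. 48] [cite: Lang1982AbelianFunctions, Ch. IX §5 Thm. 5.1] -/
theorem ncard_setOf_addEquiv_eq_ncard_stabilizer (τ : UpperHalfPlane) :
    {e : ComplexTorus (period a b ha hb τ.coe_im_pos.ne') ≃+ ComplexTorus (period a b ha hb τ.coe_im_pos.ne') |
        ContMDiff 𝓘(ℂ, Fin 2 → ℂ) 𝓘(ℂ, Fin 2 → ℂ) ω e ∧ ContMDiff 𝓘(ℂ, Fin 2 → ℂ) 𝓘(ℂ, Fin 2 → ℂ) ω e.symm ∧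
        ∀ m : Fin 4 → ℤ, ∀ t, e (mapMatrix (period a b ha hb τ.coe_im_pos.ne') (period a b ha hb τ.coe_im_pos.ne')
          (lmulInt a b m) t) = mapMatrix (period a b ha hb τ.coe_im_pos.ne') (period a b ha hb τ.coe_im_pos.ne')
          (lmulInt a b m) (e t)}.ncard =
      {γ : SL(2, ℝ) | γ ∈ unitGroup a b hb.le ∧ γ • τ = τ}.ncard := by
  rw [ncard_setOf_addEquiv_eq_natCard_units ha hb τ, natCard_units_eq_ncard_stabilizer]

/-- **`#Aut(A(τ), ι) = 4` iff `τ` is an elliptic point of `Γ`** (iff `(A(τ), ι)` carries `Z(1)`, g27-#1), for the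
automorphisms of the torus; otherwise the only ones are `±1` (g18-#3 `addEquiv_eq_refl_or_eq_neg`).
[cite: KudlaRapoportYang2006, §3.2 Prop. 3.2.1 (proof) p. 48 and §3.4 Def. 3.4.2 p. 51] [cite: Bergeron2016, §1.3.1 p. 19] -/
theorem ncard_setOf_addEquiv_eq_four_iff_exists_smul_eq (τ : UpperHalfPlane) :
    {e : ComplexTorus (period a b ha hb τ.coe_im_pos.ne') ≃+ ComplexTorus (period a b ha hb τ.coe_im_pos.ne') |
        ContMDiff 𝓘(ℂ, Fin 2 → ℂ) 𝓘(ℂ, Fin 2 → ℂ) ω e ∧ ContMDiff 𝓘(ℂ, Fin 2 → ℂ) 𝓘(ℂ, Fin 2 → ℂ) ω e.symm ∧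
        ∀ m : Fin 4 → ℤ, ∀ t, e (mapMatrix (period a b ha hb τ.coe_im_pos.ne') (period a b ha hb τ.coe_im_pos.ne')
          (lmulInt a b m) t) = mapMatrix (period a b ha hb τ.coe_im_pos.ne') (period a b ha hb τ.coe_im_pos.ne')
          (lmulInt a b m) (e t)}.ncard = 4 ↔
      ∃ γ ∈ unitGroup a b hb.le, γ ≠ 1 ∧ γ ≠ -1 ∧ γ • τ = τ := by
  rw [ncard_setOf_addEquiv_eq_natCard_units ha hb τ, natCard_units_eq_four_iff_exists_smul_eq]

/-- **Off the elliptic points the automorphisms of `(A(τ), ι)` are exactly `{1, −1}`** (g18-#3's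
`addEquiv_eq_refl_or_eq_neg` and `neg_isAutomorphism` as a set equality; `#= 2`).
[cite: KudlaRapoportYang2006, §3.2 Prop. 3.2.1 (proof) p. 48] [cite: BesserLivne2013, §3.4 Cor. 2 («modulo the action of −1»)] -/
theorem setOf_addEquiv_eq_pair_of_not_exists (τ : UpperHalfPlane)
    (hτ : ¬ ∃ γ ∈ unitGroup a b hb.le, γ ≠ 1 ∧ γ ≠ -1 ∧ γ • τ = τ) :
    {e : ComplexTorus (period a b ha hb τ.coe_im_pos.ne') ≃+ ComplexTorus (period a b ha hb τ.coe_im_pos.ne') |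
        ContMDiff 𝓘(ℂ, Fin 2 → ℂ) 𝓘(ℂ, Fin 2 → ℂ) ω e ∧ ContMDiff 𝓘(ℂ, Fin 2 → ℂ) 𝓘(ℂ, Fin 2 → ℂ) ω e.symm ∧
        ∀ m : Fin 4 → ℤ, ∀ t, e (mapMatrix (period a b ha hb τ.coe_im_pos.ne') (period a b ha hb τ.coe_im_pos.ne')
          (lmulInt a b m) t) = mapMatrix (period a b ha hb τ.coe_im_pos.ne') (period a b ha hb τ.coe_im_pos.ne')
          (lmulInt a b m) (e t)} =
      {AddEquiv.refl _, AddEquiv.neg _} := by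
  ext e
  simp only [Set.mem_setOf_eq, Set.mem_insert_iff, Set.mem_singleton_iff]
  constructor
  · rintro ⟨he, he', hcomm⟩
    exact addEquiv_eq_refl_or_eq_neg ha hb τ hτ e he he' hcomm
  · rintro (rfl | rfl)
    · exact ⟨contMDiff_id, contMDiff_id, fun m t ↦ rfl⟩
    · exact neg_isAutomorphism ha hb τ

/-- **… and at the elliptic points they are NOT just `{1, −1}`** (there are `4` of them: `±1, ±ρ_r(x̃)` with
`x̃² = −1`, g18-#4 `exists_addEquiv_sq_eq_neg_of_smul_eq`). [cite: KudlaRapoportYang2006, §3.2 Prop. 3.2.1 (proof) p. 48 and §3.4 (3.4.8) p. 51] -/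
theorem setOf_addEquiv_ne_pair_of_exists (τ : UpperHalfPlane)
    (hτ : ∃ γ ∈ unitGroup a b hb.le, γ ≠ 1 ∧ γ ≠ -1 ∧ γ • τ = τ) :
    {e : ComplexTorus (period a b ha hb τ.coe_im_pos.ne') ≃+ ComplexTorus (period a b ha hb τ.coe_im_pos.ne') |
        ContMDiff 𝓘(ℂ, Fin 2 → ℂ) 𝓘(ℂ, Fin 2 → ℂ) ω e ∧ ContMDiff 𝓘(ℂ, Fin 2 → ℂ) 𝓘(ℂ, Fin 2 → ℂ) ω e.symm ∧
        ∀ m : Fin 4 → ℤ, ∀ t, e (mapMatrix (period a b ha hb τ.coe_im_pos.ne') (period a b ha hb τ.coe_im_pos.ne')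
          (lmulInt a b m) t) = mapMatrix (period a b ha hb τ.coe_im_pos.ne') (period a b ha hb τ.coe_im_pos.ne')
          (lmulInt a b m) (e t)} ≠
      {AddEquiv.refl _, AddEquiv.neg _} := by
  intro h
  have h4 := (ncard_setOf_addEquiv_eq_four_iff_exists_smul_eq ha hb τ).2 hτ
  rw [h] at h4
  have h2 : ({AddEquiv.refl (ComplexTorus (period a b ha hb τ.coe_im_pos.ne')), AddEquiv.neg _} :
      Set (ComplexTorus (period a b ha hb τ.coe_im_pos.ne') ≃+ ComplexTorus (period a b ha hb τ.coe_im_pos.ne'))).ncard ≤ 2 := by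
    refine (Set.ncard_insert_le _ _).trans ?_
    rw [Set.ncard_singleton]
  omega

/-- **Every automorphism of `(A(τ), ι)` is `ρ_r(M)` with `M ∈ {±1}` off `Z(1)` and `M ∈ {±1, ±x̃_p}` on `Z(1)`**:
hypothesis-free, for every member, `⇑e = ρ_r(M)` with `M` a unit of `End(A(τ), ι)`, hence `M = ±1` or `M = ±x̃_p`
for the primitive special vector `p` of a CM point with `t_p = 1` (g27-#1 `isUnit_iff_of_eq_neg_one`,
`isUnit_iff_of_ne_neg_one`, `isUnit_iff_of_finrank_eq_three`). [cite: KudlaRapoportYang2006, §3.2 Prop. 3.2.1 (proof) p. 48 and §3.4 (3.4.6) p. 51] -/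
theorem exists_coe_addEquiv_eq_mapMatrix (τ : UpperHalfPlane)
    (e : ComplexTorus (period a b ha hb τ.coe_im_pos.ne') ≃+ ComplexTorus (period a b ha hb τ.coe_im_pos.ne'))
    (he : ContMDiff 𝓘(ℂ, Fin 2 → ℂ) 𝓘(ℂ, Fin 2 → ℂ) ω e) (he' : ContMDiff 𝓘(ℂ, Fin 2 → ℂ) 𝓘(ℂ, Fin 2 → ℂ) ω e.symm)
    (hcomm : ∀ m : Fin 4 → ℤ, ∀ t, e (mapMatrix (period a b ha hb τ.coe_im_pos.ne') (period a b ha hb τ.coe_im_pos.ne')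
      (lmulInt a b m) t) = mapMatrix (period a b ha hb τ.coe_im_pos.ne') (period a b ha hb τ.coe_im_pos.ne')
      (lmulInt a b m) (e t)) :
    ∃ M : Matrix (Fin 4) (Fin 4) ℤ, ⇑e = mapMatrix (period a b ha hb τ.coe_im_pos.ne') (period a b ha hb τ.coe_im_pos.ne') M ∧
      (M = 1 ∨ M = -1 ∨ ∃ p : Fin 3 → ℤ, (∃ u : Fin 3 → ℤ, ∑ k, u k * p k = 1) ∧
        castQ a b (ofStarCoords a b p) * eta a b ha hb τ.coe_im_pos.ne' =
          eta a b ha hb τ.coe_im_pos.ne' * castQ a b (ofStarCoords a b p) ∧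
        a * p 0 ^ 2 + b * p 1 ^ 2 - a * b * p 2 ^ 2 = -1 ∧ (M = specialEnd a b p ∨ M = -specialEnd a b p)) := by
  have hτ := τ.coe_im_pos.ne'
  obtain ⟨u, hu, -⟩ := ComplexTorus.exists_units_coe_eq_of_addEquiv (period a b ha hb hτ) (Set.range (lmulInt a b))
    e he he' (by simpa only [Set.forall_mem_range] using hcomm)
  refine ⟨_, hu, ?_⟩
  have hunit : IsUnit ((u : ((endRingInt (period a b ha hb hτ) ⊓ Subring.centralizer (Set.range (lmulInt a b)) :
      Subring (Matrix (Fin 4) (Fin 4) ℤ)))) : equivariantEndRingInt ha hb hτ) := u.isUnit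
  rcases finrank_neronSeveriGroup_period_eq_three_or_eq_four ha hb hτ with h3 | h4
  · rcases (isUnit_iff_of_finrank_eq_three ha hb hτ h3 _).1 hunit with h | h
    · exact Or.inl h
    · exact Or.inr (Or.inl h)
  · obtain ⟨p, hprim, hC⟩ := exists_primitive_comm_eta_of_finrank_eq_four ha hb hτ h4
    by_cases hd : a * p 0 ^ 2 + b * p 1 ^ 2 - a * b * p 2 ^ 2 = -1
    · rcases (isUnit_iff_of_eq_neg_one ha hb hτ hC hprim hd _).1 hunit with h | h | h | h
      · exact Or.inl h
      · exact Or.inr (Or.inl h)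
      · exact Or.inr (Or.inr ⟨p, hprim, hC, hd, Or.inl h⟩)
      · exact Or.inr (Or.inr ⟨p, hprim, hC, hd, Or.inr h⟩)
    · rcases (isUnit_iff_of_ne_neg_one ha hb hτ hC hprim hd _).1 hunit with h | h
      · exact Or.inl h
      · exact Or.inr (Or.inl h)

/-- **Validation `(a,b) = (−1,3)`, `τ = i`: `(A(i), ι)` has exactly `4` automorphisms** (`{±1, ±ρ_r(R_i)}`; g27-#1
`natCard_units_neg_one_three_I`, g18-#4 `automorphisms_I_neg_one_three`). [cite: KudlaRapoportYang2006, §3.2 Prop. 3.2.1 (proof) p. 48] [cite: Lang1982AbelianFunctions, Ch. IX §4 (the example `((−1, 3)_ℚ, ρ, 𝔬, (i, 1))`)] -/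
theorem ncard_setOf_addEquiv_neg_one_three_I :
    {e : ComplexTorus (period (-1) 3 (by norm_num) (by norm_num) UpperHalfPlane.I.coe_im_pos.ne') ≃+
        ComplexTorus (period (-1) 3 (by norm_num) (by norm_num) UpperHalfPlane.I.coe_im_pos.ne') |
        ContMDiff 𝓘(ℂ, Fin 2 → ℂ) 𝓘(ℂ, Fin 2 → ℂ) ω e ∧ ContMDiff 𝓘(ℂ, Fin 2 → ℂ) 𝓘(ℂ, Fin 2 → ℂ) ω e.symm ∧
        ∀ m : Fin 4 → ℤ, ∀ t, e (mapMatrix (period (-1) 3 (by norm_num) (by norm_num) UpperHalfPlane.I.coe_im_pos.ne')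
          (period (-1) 3 (by norm_num) (by norm_num) UpperHalfPlane.I.coe_im_pos.ne') (lmulInt (-1) 3 m) t) =
          mapMatrix (period (-1) 3 (by norm_num) (by norm_num) UpperHalfPlane.I.coe_im_pos.ne')
          (period (-1) 3 (by norm_num) (by norm_num) UpperHalfPlane.I.coe_im_pos.ne') (lmulInt (-1) 3 m) (e t)}.ncard = 4 := by
  exact (ncard_setOf_addEquiv_eq_four_iff_exists_smul_eq (a := -1) (b := 3) (by norm_num) (by norm_num)
    UpperHalfPlane.I).2 exists_unitGroup_smul_I_neg_one_three

end QuaternionType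

end Literature.Geometry.Kaehler.ComplexTorus
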